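import Literature.AlgebraicGeometry.AbelianSchemes.RigidifiedLineBundleSliceHomogeneous
import Literature.AlgebraicGeometry.AbelianSchemes.AbelianSchemeIsLambdaOfAtBaseChange
import Literature.AlgebraicGeometry.AbelianSchemes.PolarizedAbelianSchemeRebaseWeilPairing
import Literature.AlgebraicGeometry.AbelianSchemes.AbelianSchemeIsLambdaOfAtConjugateTransport
import Literature.AlgebraicGeometry.AbelianSchemes.AbelianSchemeFibreHom
import Literature.AlgebraicGeometry.Motives.AbelianVarietyWeilPairingAlgClosure
import Literature.AlgebraicGeometry.Motives.AbelianVarietyDegree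
import HarnessLib

/-!
# Transport of polarisation witnesses, torsion towers and Weil pairings to the IDENTITY FIBRE of a base change

Bookkeeping for the assemblers of the EHECKE closer leaf (organs (O-R1)∕(O-R2) of crux hLiu418): the analytic readings of a
polarised abelian scheme `𝒜 ∕ X` at a field-valued point `pt : Spec K ⟶ X` live on the fibre `𝒜.fibre pt = (𝒜.baseChange pt).toAffine`,
while the algebraic consumers (★ `exists_roof_of_idealHomFamily_of_isAlgClosed`, ★ `comp_lam_comp_dualIsogenyOver_eq_mulN_of_towerReadings_unit`)
are stated for an abelian scheme `A := 𝒜.baseChange pt` over `Spec K` at ITS identity point, i.e. on `(A.fibre (𝟙 _))`.  The two are related by the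
single isomorphism `fibreIdIso A : (A.fibre (𝟙 _)).toAbelianVariety ≅ A.toAffine.toAbelianVariety` of ★ `AbelianSchemeOverFibreIdentity`
(underlying scheme morphism `pullback.fst _ (𝟙 _)`).  This file records, once and for all:

* §1 (any isomorphism `e : A′ ≅ B′` of abelian varieties over a field) `e (e⁻¹ Q) = Q`, `e⁻¹ (e P) = P`; the Weil pairing of the pulled-back
  divisor `e^*Θ` at `e⁻¹ P, e⁻¹ Q` is that of `Θ` at `P, Q` (★ `weilPairingLevel_pullback_eq`, [MumfordAV1970] §20 property (3)); a surjective
  torsion tower stays surjective after `e⁻¹`; ampleness of `e^*Θ`.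
* §2 `fibreIdIso` is the component of the natural isomorphism `Over.pullback (𝟙) ≅ 𝟭`, hence commutes with `fibreHom f (𝟙 _)` versus `f` on points
  (both directions).
* §3 **`IsLambdaOfAt` moves to the identity fibre**: `𝒜.IsLambdaOfAt pt D λ Θ →
  (𝒜.baseChange pt).IsLambdaOfAt (𝟙 _) (D.baseChange pt) ((Over.pullback pt).map λ) ((fibreIdIso _)^*Θ)` — ★ `IsLambdaOfAt.of_point_eq`
  (`pt = 𝟙 ≫ pt`) followed by ★ `IsLambdaOfAt.baseChange` (`g := pt`, `t := 𝟙`) and the identification of underlying scheme morphisms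
  `e_{bc} ≫ e_{congr}⁻¹ = fibreIdIso` (`pullback.hom_ext`).

No new definitions; theorems only.

References: [MumfordAV1970] D. Mumford, *Abelian Varieties* (1970), §20 (p. 186), §23; [MumfordFogartyKirwan1994] GIT, Ch. 6 §2 Def. 6.2–6.3 (p. 120);
[GortzWedhorn2020] U. Görtz, T. Wedhorn, *Algebraic Geometry I* (2nd ed.), Section (4.7) (p. 135).
-/

noncomputable section

-- Mathlib's `Over`/pull-back API is stated across semireducible wrappers (as in the ★ `AbelianSchemes/*` files).
set_option backward.isDefEq.respectTransparency false
set_option autoImplicit false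

universe u

open CategoryTheory CategoryTheory.Limits AlgebraicGeometry
open scoped MonObj

namespace Literature.AlgebraicGeometry.AbelianSchemes

namespace AbelianSchemeOver

open Literature.AlgebraicGeometry.Motives
open Literature.AlgebraicGeometry.Motives.AbelianVariety (Hom.toSchemeHom map_mem_torsionPoints isDominant_toSchemeHom_iso_hom)

/-! ### §1 Along an isomorphism of abelian varieties over a field -/

section AlongIso

variable {K : Type u} [Field K] {A' B' : AbelianVariety K} (e : A' ≅ B')

/-- `e (e⁻¹ Q) = Q` on `L`-points, for an isomorphism `e` of abelian varieties. [cite: MumfordFogartyKirwan1994, Ch. 7 §2 Definition 7.3 (p. 130)] -/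
theorem map_isoHom_map_isoInv {L : Type u} [Field L] [Algebra K L] (Q : B'.Points L) :
    AlgPoints.map e.hom.hom.hom.hom (AlgPoints.map e.inv.hom.hom.hom Q) = Q := by
  rw [← AlgPoints.map_comp_apply]
  change AlgPoints.map (e.inv ≫ e.hom).hom.hom.hom Q = Q
  rw [e.inv_hom_id]
  exact AlgPoints.map_id_apply Q

/-- `e⁻¹ (e P) = P` on `L`-points, for an isomorphism `e` of abelian varieties. [cite: MumfordFogartyKirwan1994, Ch. 7 §2 Definition 7.3 (p. 130)] -/
theorem map_isoInv_map_isoHom {L : Type u} [Field L] [Algebra K L] (P : A'.Points L) :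
    AlgPoints.map e.inv.hom.hom.hom (AlgPoints.map e.hom.hom.hom.hom P) = P := by
  rw [← AlgPoints.map_comp_apply]
  change AlgPoints.map (e.hom ≫ e.inv).hom.hom.hom P = P
  rw [e.hom_inv_id]
  exact AlgPoints.map_id_apply P

/-- **`ē_N^{e^*Θ}(e⁻¹ P, e⁻¹ Q) = ē_N^Θ(P, Q)`** for an isomorphism `e : A′ ≅ B′` and a divisor `Θ` on `B′` (★ `weilPairingLevel_pullback_eq` at `f := e`,
images `e (e⁻¹ P) = P`). [cite: MumfordAV1970, §20 (property (3) of e_n, p. 186)] -/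
theorem weilPairingLevel_pullback_isoHom_map_isoInv (Θ : CartierDivisor B'.X.left) {N : ℕ}
    [IsDominant (Hom.toSchemeHom (((N : ℕ) : ℤ) • 𝟙 A'))] [IsDominant (Hom.toSchemeHom (((N : ℕ) : ℤ) • 𝟙 B'))]
    (P Q : B'.torsionPoints K N) :
    haveI := isDominant_toSchemeHom_iso_hom e
    A'.weilPairingLevel (Θ.pullback (Hom.toSchemeHom e.hom))
        ⟨AlgPoints.map e.inv.hom.hom.hom P.1, map_mem_torsionPoints e.inv P.2⟩
        ⟨AlgPoints.map e.inv.hom.hom.hom Q.1, map_mem_torsionPoints e.inv Q.2⟩ = B'.weilPairingLevel Θ P Q := by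
  haveI := isDominant_toSchemeHom_iso_hom e
  exact AbelianVariety.weilPairingLevel_pullback_eq e.hom Θ _ _ P Q (map_isoHom_map_isoInv e P.1).symm (map_isoHom_map_isoInv e Q.1).symm

/-- A SURJECTIVE torsion tower `l : ι → B′[N]` stays surjective after transport by `e⁻¹` (`e⁻¹ ∘ l : ι → A′[N]`). [cite: MumfordFogartyKirwan1994, Ch. 7 §1 Definition 7.1 (p. 129)] -/
theorem surjective_map_isoInv_comp {N : ℤ} {J : Type*} (l : J → B'.torsionPoints K N) (hl : Function.Surjective l) :
    Function.Surjective (fun x => (⟨AlgPoints.map e.inv.hom.hom.hom (l x).1, map_mem_torsionPoints e.inv (l x).2⟩ : A'.torsionPoints K N)) := by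
  intro P
  obtain ⟨x, hx⟩ := hl ⟨AlgPoints.map e.hom.hom.hom.hom P.1, map_mem_torsionPoints e.hom P.2⟩
  refine ⟨x, Subtype.ext ?_⟩
  change AlgPoints.map e.inv.hom.hom.hom (l x).1 = P.1
  rw [hx]
  exact map_isoInv_map_isoHom e P.1

/-- `e^*Θ` is ample when `Θ` is (an isomorphism is affine; ★ `IsAmple.pullback`). [cite: GortzWedhorn2020, Prop. 13.66 (2) (p. 509)] -/
theorem isAmple_pullback_isoHom {Θ : CartierDivisor B'.X.left} (hΘ : Θ.IsAmple) :
    haveI := isDominant_toSchemeHom_iso_hom e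
    (Θ.pullback (Hom.toSchemeHom e.hom)).IsAmple := by
  haveI := isDominant_toSchemeHom_iso_hom e
  haveI : IsIso (Hom.toSchemeHom e.hom) :=
    ⟨Hom.toSchemeHom e.inv, by change Hom.toSchemeHom (e.hom ≫ e.inv) = _; rw [e.hom_inv_id]; rfl, by
      change Hom.toSchemeHom (e.inv ≫ e.hom) = _; rw [e.inv_hom_id]; rfl⟩
  exact hΘ.pullback _

end AlongIso

/-! ### §2 `fibreIdIso` versus `fibreHom · (𝟙 _)` on points -/

section FibreId

variable {K : Type} [Field K]

/-- The underlying `Spec K`-morphism of `fibreIdIso A` is the component at `A.X` of the natural isomorphism `Over.pullback (𝟙) ≅ 𝟭`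
(both have first projection `pullback.fst _ (𝟙 _)` as underlying scheme morphism). [cite: GortzWedhorn2020, Section (4.7) (p. 135)] -/
theorem fibreIdIso_hom_hom_hom_hom (A : AbelianSchemeOver (Spec (.of K))) :
    (fibreIdIso A).hom.hom.hom.hom = (overPullbackIdIso (Spec (.of K))).hom.app A.X := by
  ext
  rw [overPullbackIdIso_hom_app_left]
  exact fibreIdToGrpIso_hom_left A

/-- **`e_B (f_{𝟙} P) = f (e_A P)`**: the identity-fibre isomorphisms intertwine the restriction `fibreHom f (𝟙 _)` of a homomorphism `f : A ⟶ B` of abelian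
schemes over `Spec K` with `f` itself, on `L`-points (naturality of `Over.pullback (𝟙) ≅ 𝟭`). [cite: GortzWedhorn2020, Section (4.7) (p. 135)] -/
theorem map_fibreIdIso_hom_map_fibreHom {A B : AbelianSchemeOver (Spec (.of K))} (f : A.X ⟶ B.X) [IsMonHom f]
    {L : Type} [Field L] [Algebra K L] (P : (A.fibre (𝟙 _)).toAbelianVariety.Points L) :
    AlgPoints.map (fibreIdIso B).hom.hom.hom.hom (AlgPoints.map (fibreHom f (𝟙 _)).hom.hom.hom P) =
      (AlgPoints.map f (AlgPoints.map (fibreIdIso A).hom.hom.hom.hom P) : B.toAffine.toAbelianVariety.Points L) := by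
  rw [← AlgPoints.map_comp_apply, ← AlgPoints.map_comp_apply, fibreHom_hom_hom_hom, fibreIdIso_hom_hom_hom_hom,
    fibreIdIso_hom_hom_hom_hom]
  congr 1
  exact (overPullbackIdIso (Spec (.of K))).hom.naturality f

/-- **`f_{𝟙} (e_A⁻¹ P) = e_B⁻¹ (f P)`** — the same with the inverse isomorphisms (the shape of the reading law `hT` of ★
`comp_lam_comp_dualIsogenyOver_eq_mulN_of_towerReadings_unit` when the towers are transported from `A.toAffine` to `A.fibre (𝟙 _)`).
[cite: GortzWedhorn2020, Section (4.7) (p. 135)] -/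
theorem map_fibreHom_map_fibreIdIso_inv {A B : AbelianSchemeOver (Spec (.of K))} (f : A.X ⟶ B.X) [IsMonHom f]
    {L : Type} [Field L] [Algebra K L] (P : A.toAffine.toAbelianVariety.Points L) :
    AlgPoints.map (fibreHom f (𝟙 _)).hom.hom.hom (AlgPoints.map (fibreIdIso A).inv.hom.hom.hom P) =
      AlgPoints.map (fibreIdIso B).inv.hom.hom.hom (AlgPoints.map f P : B.toAffine.toAbelianVariety.Points L) := by
  have h := map_fibreIdIso_hom_map_fibreHom f (AlgPoints.map (fibreIdIso A).inv.hom.hom.hom P)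
  rw [map_isoHom_map_isoInv] at h
  rw [← h, map_isoInv_map_isoHom]

/-- Points form: `e_B (f_{𝟙} Q) = R ↔ f (e_A Q) = R`. [cite: GortzWedhorn2020, Section (4.7) (p. 135)] -/
theorem map_fibreHom_eq_map_fibreIdIso_inv_iff {A B : AbelianSchemeOver (Spec (.of K))} (f : A.X ⟶ B.X) [IsMonHom f]
    {L : Type} [Field L] [Algebra K L] (Q : (A.fibre (𝟙 _)).toAbelianVariety.Points L) (R : B.toAffine.toAbelianVariety.Points L) :
    AlgPoints.map (fibreHom f (𝟙 _)).hom.hom.hom Q = AlgPoints.map (fibreIdIso B).inv.hom.hom.hom R ↔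
      (AlgPoints.map f (AlgPoints.map (fibreIdIso A).hom.hom.hom.hom Q) : B.toAffine.toAbelianVariety.Points L) = R := by
  rw [← map_fibreIdIso_hom_map_fibreHom f Q]
  constructor
  · intro h
    rw [h, map_isoHom_map_isoInv]
  · intro h
    rw [← h, map_isoInv_map_isoHom]

end FibreId

/-! ### §3 `IsLambdaOfAt` at `pt` moves to the identity fibre of `𝒜.baseChange pt` -/

section ToIdentityFibre

/-- `e_{congr}⁻¹` commutes with the first projections: for `h : s₁ = s₂`, `(fibreCongrIso h)⁻¹ ≫ pr_{s₁} = pr_{s₂}` on underlying schemes.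
[cite: GortzWedhorn2020, Section (4.7) (p. 135)] -/
theorem toSchemeHom_fibreCongrIso_inv_comp_fst {S : Scheme.{u}} (A : AbelianSchemeOver S) {L : Type u} [Field L]
    {s₁ s₂ : Spec (.of L) ⟶ S} (h : s₁ = s₂) :
    Hom.toSchemeHom (A.fibreCongrIso h).inv ≫ pullback.fst A.X.hom s₁ = pullback.fst A.X.hom s₂ := by
  subst h
  simp only [fibreCongrIso, eqToIso_refl, Iso.refl_inv]
  exact Category.id_comp _

variable {X : Scheme.{0}} (𝒜 : AbelianSchemeOver X) {K : Type} [Field K] (pt : Spec (.of K) ⟶ X)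

/-- **The underlying scheme morphism of `fibreIdIso (𝒜.baseChange pt)` is `e_{bc} ≫ e_{congr}⁻¹`**, where `e_{bc} : (𝒜_{pt})_{𝟙} ≅ 𝒜_{𝟙 ≫ pt}` is ★
`fibreBaseChangeIso pt (𝟙 _)` and `e_{congr} : 𝒜_{pt} ≅ 𝒜_{𝟙 ≫ pt}` is ★ `fibreCongrIso` (all three have first projection `pr_{𝟙} ≫ pr_{pt}`; `pullback.hom_ext`).
[cite: GortzWedhorn2020, Section (4.7) (p. 135)] -/
theorem toSchemeHom_fibreBaseChangeIso_hom_comp_fibreCongrIso_inv :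
    Hom.toSchemeHom (𝒜.fibreBaseChangeIso pt (𝟙 _)).hom ≫ Hom.toSchemeHom (𝒜.fibreCongrIso (Category.id_comp pt).symm).inv =
      Hom.toSchemeHom (fibreIdIso (𝒜.baseChange pt)).hom := by
  apply pullback.hom_ext
  · rw [Category.assoc, toSchemeHom_fibreCongrIso_inv_comp_fst, fibreBaseChangeIso_hom_toSchemeHom_fst]
    change _ = (fibreIdToGrpIso (𝒜.baseChange pt)).hom.hom.hom.left ≫ _
    rw [fibreIdToGrpIso_hom_left]
    rfl
  · rw [Category.assoc]
    have w₁ := Over.w (𝒜.fibreCongrIso (Category.id_comp pt).symm).inv.hom.hom.hom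
    have w₂ := Over.w (fibreIdIso (𝒜.baseChange pt)).hom.hom.hom.hom
    have w₃ := 𝒜.fibreBaseChangeIso_hom_toSchemeHom_snd pt (𝟙 _)
    change _ ≫ (𝒜.fibreCongrIso (Category.id_comp pt).symm).inv.hom.hom.hom.left ≫ ((𝒜.fibre pt).toAbelianVariety.X).hom =
      (fibreIdIso (𝒜.baseChange pt)).hom.hom.hom.hom.left ≫ ((𝒜.baseChange pt).toAffine.toAbelianVariety.X).hom
    rw [w₁, w₂]
    exact w₃

/-- **`λ̄ = Λ(𝒪(Θ))` at the point `pt` of `X` ⟹ the same for the base change `𝒜_{pt} ∕ Spec K` at its identity point, with the divisor transported along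
`fibreIdIso`**: `𝒜.IsLambdaOfAt pt D λ Θ → (𝒜.baseChange pt).IsLambdaOfAt (𝟙 _) (D.baseChange pt) ((Over.pullback pt).map λ) ((fibreIdIso (𝒜.baseChange pt))^*Θ)` — ★
`IsLambdaOfAt.of_point_eq` along `pt = 𝟙 ≫ pt`, ★ `IsLambdaOfAt.baseChange` (`g := pt`, `t := 𝟙`), and `e_{bc}^*(e_{congr}⁻¹)^*Θ ∼ (fibreIdIso)^*Θ`
(`toSchemeHom_fibreBaseChangeIso_hom_comp_fibreCongrIso_inv`, ★ `IsLambdaOfAt.of_sameDivisor`).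
[cite: MumfordFogartyKirwan1994, Ch. 6 §2 Definition 6.2–6.3 (p. 120)] [cite: GortzWedhorn2020, Section (4.7) (p. 135)] -/
theorem IsLambdaOfAt.toIdentityFibre (D : 𝒜.DualPair) (lam : 𝒜.X ⟶ D.hat.X)
    {Θ : CartierDivisor (𝒜.fibre pt).toAbelianVariety.X.left} (h : 𝒜.IsLambdaOfAt pt D lam Θ) :
    haveI := isDominant_toSchemeHom_iso_hom (fibreIdIso (𝒜.baseChange pt))
    (𝒜.baseChange pt).IsLambdaOfAt (𝟙 _) (D.baseChange pt) ((Over.pullback pt).map lam)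
      (Θ.pullback (Hom.toSchemeHom (fibreIdIso (𝒜.baseChange pt)).hom)) := by
  haveI := isDominant_toSchemeHom_iso_hom (fibreIdIso (𝒜.baseChange pt))
  haveI : IsDominant (Hom.toSchemeHom (𝒜.fibreCongrIso (Category.id_comp pt).symm).inv) :=
    isDominant_toSchemeHom_iso_hom (𝒜.fibreCongrIso (Category.id_comp pt).symm).symm
  haveI := 𝒜.isIso_toSchemeHom_fibreBaseChangeIso pt (𝟙 _)
  have h₁ := IsLambdaOfAt.of_point_eq 𝒜 D lam (Category.id_comp pt).symm h
  have h₂ := IsLambdaOfAt.baseChange 𝒜 pt D (𝟙 _) lam _ h₁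
  refine IsLambdaOfAt.of_sameDivisor _ _ _ _ ?_ h₂
  refine (CartierDivisor.pullback_pullback_sameDivisor Θ _ _).trans ?_
  exact CartierDivisor.pullback_congr_sameDivisor Θ (toSchemeHom_fibreBaseChangeIso_hom_comp_fibreCongrIso_inv 𝒜 pt)

/-- The transported divisor is ample when `Θ` is. [cite: GortzWedhorn2020, Prop. 13.66 (2) (p. 509)] -/
theorem isAmple_pullback_fibreIdIso {Θ : CartierDivisor (𝒜.fibre pt).toAbelianVariety.X.left} (hΘ : Θ.IsAmple) :
    haveI := isDominant_toSchemeHom_iso_hom (fibreIdIso (𝒜.baseChange pt))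
    (Θ.pullback (Hom.toSchemeHom (fibreIdIso (𝒜.baseChange pt)).hom)).IsAmple :=
  isAmple_pullback_isoHom (fibreIdIso (𝒜.baseChange pt)) hΘ

end ToIdentityFibre

/-! ### §4 (ED. 2) The underlying scheme morphism of `fibreHom f (𝟙 _)` is `e_A ≫ f ≫ e_B⁻¹`; dominance and affineness transport -/

section FibreHomId

variable {K : Type} [Field K] {A B : AbelianSchemeOver (Spec (.of K))} (f : A.X ⟶ B.X) [IsMonHom f]

/-- `f_{𝟙} ≫ e_B = e_A ≫ f` as `Spec K`-morphisms (naturality of `Over.pullback (𝟙) ≅ 𝟭`). [cite: GortzWedhorn2020, Section (4.7) (p. 135)] -/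
theorem fibreHom_id_hom_hom_hom_comp_fibreIdIso :
    (fibreHom f (𝟙 _)).hom.hom.hom ≫ (fibreIdIso B).hom.hom.hom.hom = (fibreIdIso A).hom.hom.hom.hom ≫ f := by
  rw [fibreHom_hom_hom_hom, fibreIdIso_hom_hom_hom_hom, fibreIdIso_hom_hom_hom_hom]
  exact (overPullbackIdIso (Spec (.of K))).hom.naturality f

/-- `f_{𝟙} = e_A ≫ f ≫ e_B⁻¹` as `Spec K`-morphisms. [cite: GortzWedhorn2020, Section (4.7) (p. 135)] -/
theorem fibreHom_id_hom_hom_hom_eq :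
    (fibreHom f (𝟙 _)).hom.hom.hom = (fibreIdIso A).hom.hom.hom.hom ≫ f ≫ (fibreIdIso B).inv.hom.hom.hom := by
  rw [← Category.assoc, ← fibreHom_id_hom_hom_hom_comp_fibreIdIso, Category.assoc]
  change _ = _ ≫ ((fibreIdIso B).hom ≫ (fibreIdIso B).inv).hom.hom.hom
  rw [Iso.hom_inv_id]
  exact (Category.comp_id _).symm

/-- **`toSchemeHom (fibreHom f (𝟙 _)) = toSchemeHom e_A ≫ f.left ≫ toSchemeHom e_B⁻¹`** on underlying schemes. [cite: GortzWedhorn2020, Section (4.7) (p. 135)] -/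
theorem toSchemeHom_fibreHom_id_eq :
    Hom.toSchemeHom (fibreHom f (𝟙 _)) = Hom.toSchemeHom (fibreIdIso A).hom ≫ f.left ≫ Hom.toSchemeHom (fibreIdIso B).inv := by
  change (fibreHom f (𝟙 _)).hom.hom.hom.left = _
  rw [fibreHom_id_hom_hom_hom_eq]
  rfl

/-- `f_{𝟙}` is dominant when `f` is (e.g. `f` the underlying morphism of an isogeny). [cite: MumfordAV1970, §4 (definition of isogeny) and §19 Thm. 3 (p. 176)] -/
theorem isDominant_toSchemeHom_fibreHom_id [IsDominant f.left] : IsDominant (Hom.toSchemeHom (fibreHom f (𝟙 _))) := by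
  haveI := isDominant_toSchemeHom_iso_hom (fibreIdIso A)
  haveI := isDominant_toSchemeHom_iso_hom (fibreIdIso B).symm
  rw [toSchemeHom_fibreHom_id_eq]
  change IsDominant (_ ≫ f.left ≫ Hom.toSchemeHom (fibreIdIso B).symm.hom)
  infer_instance

/-- `f_{𝟙}` is affine when `f` is (e.g. `f` the underlying morphism of an isogeny, which is finite). [cite: MumfordAV1970, §4 (definition of isogeny) and §19 Thm. 3 (p. 176)] -/
theorem isAffineHom_toSchemeHom_fibreHom_id [IsAffineHom f.left] : IsAffineHom (Hom.toSchemeHom (fibreHom f (𝟙 _))) := by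
  haveI : IsIso (Hom.toSchemeHom (fibreIdIso A).hom) :=
    ⟨Hom.toSchemeHom (fibreIdIso A).inv, by change Hom.toSchemeHom ((fibreIdIso A).hom ≫ (fibreIdIso A).inv) = _; rw [Iso.hom_inv_id]; rfl, by
      change Hom.toSchemeHom ((fibreIdIso A).inv ≫ (fibreIdIso A).hom) = _; rw [Iso.inv_hom_id]; rfl⟩
  haveI : IsIso (Hom.toSchemeHom (fibreIdIso B).inv) :=
    ⟨Hom.toSchemeHom (fibreIdIso B).hom, by change Hom.toSchemeHom ((fibreIdIso B).inv ≫ (fibreIdIso B).hom) = _; rw [Iso.inv_hom_id]; rfl, by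
      change Hom.toSchemeHom ((fibreIdIso B).hom ≫ (fibreIdIso B).inv) = _; rw [Iso.hom_inv_id]; rfl⟩
  rw [toSchemeHom_fibreHom_id_eq]
  infer_instance

/-- Both at once from an ISOGENY-like `f` (surjective and finite underlying morphism, ★ `AbelianVariety.IsIsogeny`): `f_{𝟙}` is dominant and affine — the instance binders of ★
`comp_lam_comp_dualIsogenyOver_eq_mulN_of_towerReadings_unit`. [cite: MumfordAV1970, §4 (definition of isogeny) and §19 Thm. 3 (p. 176)] -/
theorem isDominant_and_isAffineHom_toSchemeHom_fibreHom_id [Surjective f.left] [IsFinite f.left] :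
    IsDominant (Hom.toSchemeHom (fibreHom f (𝟙 _))) ∧ IsAffineHom (Hom.toSchemeHom (fibreHom f (𝟙 _))) :=
  ⟨isDominant_toSchemeHom_fibreHom_id f, isAffineHom_toSchemeHom_fibreHom_id f⟩

end FibreHomId

end AbelianSchemeOver

end Literature.AlgebraicGeometry.AbelianSchemes

end
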